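import Summits.QuantumFields.YangMills.Theorems.LangevinControlUVFemtoCurvatureTwoPointStrictRPOddTransferForm
import Summits.QuantumFields.YangMills.Theorems.LangevinControlUVFemtoCurvatureTwoPointStrictRPSiteStrict

/-!
# Crux `FemtoCurvatureTwoPoint` (stmt-QuantumFields-9363, route `LangevinControlUV`):
# strict positivity of the axis covariance — the theorem on the odd torus

Helper for the registered sub-goal `stub_axisPositive` (`--supports stmt-QuantumFields-9363`):
for `L` odd, `L ≥ 3`, `β > 0`, `G ≠ 1` compact with a continuous faithful unitary `ρ`, and a spatial
plaquette `q` in the middle slice `t = L/2`, the covariance of `Re tr ρ(U_q)` with its odd mirror is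
STRICTLY positive (`cov_timeReflect_pair_pos_odd`). Route: if it vanished, the centred reflection form
vanishes, hence (part `…OddTransferForm`) the crossing-free slab functional vanishes identically
(continuity), hence by the transfer form the slice kernel of the middle slice annihilates
`(Re tr ρ(W_q) − m) · restOddWeight`, contradicting the slice lemma (`…SliceLemma`).
-/

set_option autoImplicit false

noncomputable section

namespace Summit.QuantumFields.YangMills.Theorems.FemtoCurvatureTwoPoint.StrictRP

open MeasureTheory Finset
open scoped Matrix ComplexConjugate
open Literature.MathematicalPhysics.QuantumFieldTheory

section OddMain

variable {d L N : ℕ} [NeZero d] [NeZero L] {G : Type*} [Group G]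
  [TopologicalSpace G] [IsTopologicalGroup G] [CompactSpace G] [MeasurableSpace G] [BorelSpace G]
  (ρ : G →* Matrix (Fin N) (Fin N) ℂ)

/-- The complex crossing-free slab functional of the centred plaquette observable is the real one
times the shared half-weight. [folklore] -/
theorem integral_oObs_eq_chiOddR [Fact (1 < L)] (β : ℝ) (q : Plaquette d L) (m : ℝ) (V : GaugeConfig d L G) :
    ∫ W, WilsonOddRP.oObs ρ β (fun U => ((WilsonRP.plaqRe ρ U q - m : ℝ) : ℂ))
        (LatticeRP.splice (WilsonOddRP.oPosEdges ∪ WilsonOddRP.lowerEdges) (V, W))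
        ∂(LatticeRP.piMeasure (ι := Edge d L) (haarProbability G)) =
      ((chiOddR ρ β q m V * Real.exp (β / 2 * WilsonOddRP.oSharedAction ρ V) : ℝ) : ℂ) := by
  have hS : ∀ W, WilsonOddRP.oSharedAction ρ
      (LatticeRP.splice (WilsonOddRP.oPosEdges ∪ WilsonOddRP.lowerEdges) (V, W)) =
      WilsonOddRP.oSharedAction ρ V := fun W =>
    WilsonOddRP.dependsOn_oSharedAction ρ fun e he => by
      have h1 : e ∉ (WilsonOddRP.oPosEdges : Finset (Edge d L)) :=
        Finset.disjoint_left.1 WilsonOddRP.disjoint_oSharedEdges_oPosEdges (Finset.mem_coe.1 he)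
      have h2 : e ∉ (WilsonOddRP.lowerEdges : Finset (Edge d L)) :=
        Finset.disjoint_left.1 WilsonOddRP.disjoint_oSharedEdges_lowerEdges (Finset.mem_coe.1 he)
      have : e ∉ (WilsonOddRP.oPosEdges ∪ WilsonOddRP.lowerEdges : Finset (Edge d L)) := by
        rw [Finset.mem_union]; exact fun h => h.elim h1 h2
      simp only [LatticeRP.splice_apply, if_neg this]
  have hpt : ∀ W, WilsonOddRP.oObs ρ β (fun U => ((WilsonRP.plaqRe ρ U q - m : ℝ) : ℂ))
      (LatticeRP.splice (WilsonOddRP.oPosEdges ∪ WilsonOddRP.lowerEdges) (V, W)) =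
      ((((WilsonRP.plaqRe ρ (LatticeRP.splice (WilsonOddRP.oPosEdges ∪ WilsonOddRP.lowerEdges) (V, W)) q - m) *
        Real.exp (β * WilsonOddRP.oPosAction ρ
          (LatticeRP.splice (WilsonOddRP.oPosEdges ∪ WilsonOddRP.lowerEdges) (V, W)))) *
        Real.exp (β / 2 * WilsonOddRP.oSharedAction ρ V) : ℝ) : ℂ) := fun W => by
    unfold WilsonOddRP.oObs
    rw [hS W, Real.exp_add]
    push_cast
    ring
  simp_rw [hpt]
  rw [integral_complex_ofReal, integral_mul_const]
  rfl

/-- The four links of a spatial plaquette in the middle slice are middle-slice links. [folklore] -/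
theorem edges_mem_midEdges {q : Plaquette d L} (hq : q.2.1.1 ≠ 0) (hqt : (q.1 0).val = L / 2) :
    (q.1, q.2.1.1) ∈ (midEdges : Finset (Edge d L)) ∧
      (q.1.shift q.2.1.1, q.2.1.2) ∈ (midEdges : Finset (Edge d L)) ∧
      (q.1.shift q.2.1.2, q.2.1.1) ∈ (midEdges : Finset (Edge d L)) ∧
      (q.1, q.2.1.2) ∈ (midEdges : Finset (Edge d L)) := by
  have hj : q.2.1.2 ≠ 0 := WilsonRP.plaq_snd_ne_zero q
  refine ⟨?_, ?_, ?_, ?_⟩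
  · rw [mem_midEdges]; exact ⟨hq, hqt⟩
  · rw [mem_midEdges, WilsonRP.val_shift_of_ne _ (Ne.symm hq)]; exact ⟨hj, hqt⟩
  · rw [mem_midEdges, WilsonRP.val_shift_of_ne _ hj.symm]; exact ⟨hq, hqt⟩
  · rw [mem_midEdges]; exact ⟨hj, hqt⟩

/-- **Strict reflection positivity for odd-mirror plaquette pairs.** For a compact group `G ≠ 1` with
a continuous faithful unitary representation `ρ`, `β > 0`, `L` odd with `L ≥ 3`, and a spatial
plaquette `q` in the middle slice `t = L/2`, the covariance of `Re tr ρ(U_q)` with its odd mirror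
`Re tr ρ(U_{θq})` (time `1 − L/2`) under the Wilson measure is STRICTLY positive. [folklore] -/
theorem cov_timeReflect_pair_pos_odd [Fact (1 < L)] (hL : Odd L) (hL3 : 3 ≤ L) (hρ : Continuous ρ)
    (hinj : Function.Injective ρ) (hunit : ∀ g, ρ g ∈ Matrix.unitaryGroup (Fin N) ℂ)
    (hG : ∃ g : G, g ≠ 1) {β : ℝ} (hβ : 0 < β) {q : Plaquette d L} (hq : q.2.1.1 ≠ 0)
    (hqt : (q.1 0).val = L / 2) :
    0 < wilsonExpectation ρ β (fun U : GaugeConfig d L G =>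
          WilsonRP.plaqRe ρ U (q.1.timeReflect, q.2) * WilsonRP.plaqRe ρ U q)
        - wilsonExpectation ρ β (fun U : GaugeConfig d L G =>
            WilsonRP.plaqRe ρ U (q.1.timeReflect, q.2))
          * wilsonExpectation ρ β (fun U : GaugeConfig d L G => WilsonRP.plaqRe ρ U q) := by
  classical
  haveI := isProbabilityMeasure_wilsonMeasure (d := d) (L := L) ρ hρ β
  have h1L : 1 < L := Fact.out
  have h1q : 1 ≤ (q.1 0).val := by rw [hqt]; omega
  have h2q : (q.1 0).val ≤ L / 2 := le_of_eq hqt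
  have hnn := AxisCovNonneg.cov_timeReflect_pair_nonneg_odd ρ hL hL3 hρ hβ.le hq h1q h2q
  refine lt_of_le_of_ne hnn fun hcov => ?_
  haveI hT2 : T2Space G := (hρ.isClosedEmbedding hinj).isEmbedding.t2Space
  haveI hSC : SecondCountableTopology G :=
    haveI : SecondCountableTopology (Matrix (Fin N) (Fin N) ℂ) :=
      inferInstanceAs (SecondCountableTopology (Fin N → Fin N → ℂ))
    (hρ.isClosedEmbedding hinj).isEmbedding.secondCountableTopology
  haveI : (haarProbability G).IsOpenPosMeasure := by unfold haarProbability; infer_instance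
  set μ : Measure (GaugeConfig d L G) := LatticeRP.piMeasure (ι := Edge d L) (haarProbability G)
    with hμ
  set ν : Measure (GaugeConfig d L G) := wilsonMeasure (d := d) (L := L) ρ β with hν
  set m : ℝ := ∫ U, WilsonRP.plaqRe ρ U q ∂ν with hm
  -- (1) the centred reflection form of the plaquette vanishes
  have hrefl : ∀ U : GaugeConfig d L G, WilsonRP.plaqRe ρ U.timeReflect q =
      WilsonRP.plaqRe ρ U (q.1.timeReflect, q.2) := fun U => by
    rw [WilsonRP.plaqRe_timeReflect ρ hρ U q, AxisCovNonneg.plaqReflect_of_ne hq]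
  have hPm : Measurable fun U : GaugeConfig d L G => WilsonRP.plaqRe ρ U q :=
    WilsonRP.measurable_plaqRe ρ hρ q
  have hPb : ∀ U : GaugeConfig d L G, |WilsonRP.plaqRe ρ U q| ≤ N := fun U =>
    WilsonRP.abs_plaqRe_le ρ hρ U q
  have hPΘm : Measurable fun U : GaugeConfig d L G => WilsonRP.plaqRe ρ U.timeReflect q :=
    hPm.comp WilsonRP.measurable_timeReflect
  have hbd : ∀ U : GaugeConfig d L G, ‖WilsonRP.plaqRe ρ U q‖ ≤ N := fun U => by
    rw [Real.norm_eq_abs]; exact hPb U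
  have iP : Integrable (fun U => WilsonRP.plaqRe ρ U q) ν :=
    Integrable.of_bound hPm.aestronglyMeasurable N (ae_of_all _ hbd)
  have iPΘ : Integrable (fun U : GaugeConfig d L G => WilsonRP.plaqRe ρ U.timeReflect q) ν :=
    Integrable.of_bound hPΘm.aestronglyMeasurable N (ae_of_all _ fun U => hbd _)
  have iprod : Integrable (fun U : GaugeConfig d L G =>
      WilsonRP.plaqRe ρ U.timeReflect q * WilsonRP.plaqRe ρ U q) ν :=
    Integrable.of_bound (hPΘm.mul hPm).aestronglyMeasurable (N * N) (ae_of_all _ fun U => by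
      rw [norm_mul]; exact mul_le_mul (hbd _) (hbd _) (norm_nonneg _) (Nat.cast_nonneg _))
  have hEΘ : ∫ U, WilsonRP.plaqRe ρ U.timeReflect q ∂ν = m :=
    FiniteSusceptibilityWeakCoupling.RPCauchySchwarz.integral_comp_eq WilsonRP.measurable_timeReflect
      (FiniteSusceptibilityWeakCoupling.RPCauchySchwarz.wilsonMeasure_map_timeReflect ρ hρ β) hPm
  have hcov' : ∫ U, WilsonRP.plaqRe ρ U.timeReflect q * WilsonRP.plaqRe ρ U q ∂ν - m * m = 0 := by
    have h := hcov
    simp only [wilsonExpectation, ← hrefl] at h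
    rw [hEΘ] at h
    linarith
  have hcentred : ∫ U, (WilsonRP.plaqRe ρ U.timeReflect q - m) * (WilsonRP.plaqRe ρ U q - m) ∂ν = 0 := by
    have hexp : (fun U : GaugeConfig d L G =>
        (WilsonRP.plaqRe ρ U.timeReflect q - m) * (WilsonRP.plaqRe ρ U q - m)) =
        fun U => (WilsonRP.plaqRe ρ U.timeReflect q * WilsonRP.plaqRe ρ U q - m * WilsonRP.plaqRe ρ U q) -
          (m * WilsonRP.plaqRe ρ U.timeReflect q - m * m) := by
      funext U; ring
    have i1 : Integrable (fun U : GaugeConfig d L G =>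
        WilsonRP.plaqRe ρ U.timeReflect q * WilsonRP.plaqRe ρ U q - m * WilsonRP.plaqRe ρ U q) ν :=
      iprod.sub (iP.const_mul m)
    have i2 : Integrable (fun U : GaugeConfig d L G =>
        m * WilsonRP.plaqRe ρ U.timeReflect q - m * m) ν := (iPΘ.const_mul m).sub (integrable_const _)
    rw [hexp, integral_sub i1 i2, integral_sub iprod (iP.const_mul m),
      integral_sub (iPΘ.const_mul m) (integrable_const _), integral_const_mul, integral_const_mul, hEΘ,
      integral_const, probReal_univ, one_smul, ← hm]
    linarith
  -- (2) complex form and the weight integral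
  set Fc : GaugeConfig d L G → ℂ := fun U => ((WilsonRP.plaqRe ρ U q - m : ℝ) : ℂ) with hFc
  have hC : wilsonExpectation ρ β (fun U => conj (Fc U.timeReflect) * Fc U) = 0 := by
    unfold wilsonExpectation
    simp only [hFc, Complex.conj_ofReal, ← Complex.ofReal_mul]
    rw [integral_complex_ofReal, hcentred, Complex.ofReal_zero]
  have hW := integral_weight_mul_eq_zero ρ hρ β hC
  -- (3) odd reflection positivity with equality: the crossing-free slab functional has zero L² norm
  have hFm : Measurable Fc := Complex.measurable_ofReal.comp (hPm.sub_const m)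
  have hFb : ∀ U, ‖Fc U‖ ≤ N + |m| := fun U => by
    simp only [hFc, Complex.norm_real, Real.norm_eq_abs]
    exact (abs_sub _ _).trans (add_le_add (hPb U) le_rfl)
  have hFdep : DependsOn Fc ((WilsonOddRP.oPosEdges ∪ WilsonOddRP.oSharedEdges :
      Finset (Edge d L)) : Set (Edge d L)) := fun U U' hUU' => by
    have h := AxisCovNonneg.dependsOn_plaqRe_sub_oddPos ρ hq h1q h2q m hUU'
    dsimp only at h
    simp only [hFc, h]
  have hχχ0 := integral_oddChi_normSq_eq_zero ρ hL hρ hβ.le hFm hFb hFdep hW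
  set χ : GaugeConfig d L G → ℂ := fun V =>
    ∫ W, WilsonOddRP.oObs ρ β Fc
      (LatticeRP.splice (WilsonOddRP.oPosEdges ∪ WilsonOddRP.lowerEdges) (V, W)) ∂μ with hχ
  have hχχ : ∫ V, χ V * conj (χ V) ∂μ = 0 := hχχ0
  have hnorm : ∫ V, ‖χ V‖ ^ 2 ∂μ = 0 := by
    have hpt : ∀ V, χ V * conj (χ V) = ((‖χ V‖ ^ 2 : ℝ) : ℂ) := fun V => by
      rw [Complex.mul_conj, Complex.normSq_eq_norm_sq]
    have h := hχχ
    simp_rw [hpt] at h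
    rw [integral_complex_ofReal] at h
    exact_mod_cast h
  -- (4) the slab functional is continuous, hence identically zero
  have hobs_c : Continuous (WilsonOddRP.oObs ρ β Fc : GaugeConfig d L G → ℂ) := by
    have hA : Continuous (WilsonOddRP.oPosAction (d := d) (L := L) (G := G) ρ) := by
      unfold WilsonOddRP.oPosAction; exact continuous_sum_plaqRe ρ hρ _
    have hM : Continuous (WilsonOddRP.oSharedAction (d := d) (L := L) (G := G) ρ) := by
      unfold WilsonOddRP.oSharedAction; exact continuous_sum_plaqRe ρ hρ _
    unfold WilsonOddRP.oObs
    exact (Complex.continuous_ofReal.comp ((continuous_plaqRe ρ hρ q).sub continuous_const)).mul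
      (Complex.continuous_ofReal.comp (Real.continuous_exp.comp
        ((continuous_const.mul hA).add (continuous_const.mul hM))))
  have hχc : Continuous χ := by
    have h := continuous_parametric_integral_of_continuous (μ := μ)
      (f := fun (V W : GaugeConfig d L G) => WilsonOddRP.oObs ρ β Fc
        (LatticeRP.splice (WilsonOddRP.oPosEdges ∪ WilsonOddRP.lowerEdges) (V, W)))
      (hobs_c.comp (continuous_splice _)) isCompact_univ
    simpa only [Measure.restrict_univ] using h
  set Cobs : ℝ := |((N : ℝ) + |m|)| * Real.exp ((|β| + |β / 2|) * (N * Fintype.card (Plaquette d L)))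
    with hCobs
  have hχb : ∀ V, ‖χ V‖ ≤ Cobs := fun V => by
    have h := norm_integral_le_of_norm_le_const (μ := μ) (ae_of_all _ fun W =>
      WilsonOddRP.norm_oObs_le ρ hρ β hFb
        (LatticeRP.splice (WilsonOddRP.oPosEdges ∪ WilsonOddRP.lowerEdges) (V, W)))
    rwa [probReal_univ, mul_one] at h
  have hχ0 : ∀ V, χ V = 0 := by
    have hg_c : Continuous fun V => ‖χ V‖ ^ 2 := (hχc.norm).pow 2
    have hg_i : Integrable (fun V => ‖χ V‖ ^ 2) μ := by
      refine Integrable.of_bound hg_c.measurable.aestronglyMeasurable (Cobs ^ 2)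
        (ae_of_all _ fun V => ?_)
      rw [Real.norm_eq_abs, abs_of_nonneg (by positivity)]
      exact pow_le_pow_left₀ (norm_nonneg _) (hχb V) 2
    have hae : (fun V => ‖χ V‖ ^ 2) =ᵐ[μ] 0 :=
      (integral_eq_zero_iff_of_nonneg (fun V => by positivity) hg_i).1 hnorm
    have hfun : (fun V => ‖χ V‖ ^ 2) = 0 := (Continuous.ae_eq_iff_eq μ hg_c continuous_const).1 hae
    intro V
    have := congr_fun hfun V
    simpa using this
  -- (5) hence the real slab functional vanishes identically
  have hchiR : ∀ V, chiOddR ρ β q m V = 0 := fun V => by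
    have h := integral_oObs_eq_chiOddR ρ β q m V
    have h0 : χ V = 0 := hχ0 V
    simp only [hχ] at h0
    rw [h0] at h
    have h' : chiOddR ρ β q m V * Real.exp (β / 2 * WilsonOddRP.oSharedAction ρ V) = 0 := by
      exact_mod_cast h.symm
    exact (mul_eq_zero.1 h').resolve_right (Real.exp_pos _).ne'
  -- (6) the slice kernel of the middle slice annihilates `(Re tr ρ(W_q) − m) · restOddWeight`
  have h0 : ∀ A : GaugeConfig d L G, ∫ W, (WilsonRP.plaqRe ρ W q - m) * restOddWeight ρ β W *
      sliceKernel ρ β midEdges A W ∂μ = 0 := by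
    intro A
    have h := hchiR (topConfig A)
    rw [chiOddR_eq_integral_sliceKernel ρ hL3 hρ hunit hβ.le hq hqt m (topConfig A)] at h
    rw [← h]
    refine integral_congr_ae (ae_of_all _ fun W => ?_)
    dsimp only
    rw [sliceKernel_congr_left ρ (fun e he => (shiftUp_topConfig hL3 (A := A) he)) W]
    unfold restOddWeight
    rw [restOddAction_congr ρ (fun e he => (splice_eq_of_isRestEdge (topConfig A) W he))]
  -- (7) the slice lemma
  obtain ⟨e1, e2, e3, e4⟩ := edges_mem_midEdges (d := d) (L := L) hq hqt
  have hsplc : Continuous fun W : GaugeConfig d L G =>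
      LatticeRP.splice (WilsonOddRP.oPosEdges ∪ WilsonOddRP.lowerEdges) ((fun _ => (1 : G)), W) :=
    (continuous_splice _).comp (continuous_const.prodMk continuous_id)
  have hrc : Continuous (restOddWeight ρ β : GaugeConfig d L G → ℝ) :=
    Real.continuous_exp.comp (((continuous_sum_plaqRe ρ hρ _).comp hsplc).const_mul β)
  have hrm : Measurable (restOddWeight ρ β : GaugeConfig d L G → ℝ) :=
    (((measurable_sum_plaqRe ρ hρ _).comp ((LatticeRP.measurable_splice _).comp
      (measurable_const.prodMk measurable_id))).const_mul β).exp
  have hrb : ∀ W : GaugeConfig d L G, |restOddWeight ρ β W| ≤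
      Real.exp (β * (N * Fintype.card (Plaquette d L))) := fun W => by
    unfold restOddWeight
    rw [abs_of_pos (Real.exp_pos _)]
    refine Real.exp_le_exp.2 (mul_le_mul_of_nonneg_left ?_ hβ.le)
    exact (le_abs_self _).trans (abs_sum_plaqRe_le ρ hρ _ _)
  have hrpos : ∀ W : GaugeConfig d L G, 0 < restOddWeight ρ β W := fun W => Real.exp_pos _
  exact false_of_forall_integral_sliceKernel_eq_zero ρ hρ hinj hunit hG hβ midEdges q e1 e2 e3 e4
    (restOddWeight ρ β) hrc hrm hrb hrpos m h0

end OddMain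

/-- **Registered sub-goal `stub_oddMirrorPos`** (`--supports stmt-QuantumFields-9363`): closed form of `cov_timeReflect_pair_pos_odd` — strict positivity of odd-mirror plaquette covariances in the middle slice, all `β > 0`. [folklore] -/
theorem stub_oddMirrorPos : ∀ (d L N : ℕ) [NeZero d] [NeZero L] [Fact (1 < L)] (G : Type) [Group G] [TopologicalSpace G] [IsTopologicalGroup G] [CompactSpace G] [MeasurableSpace G] [BorelSpace G] (ρ : G →* Matrix (Fin N) (Fin N) ℂ), Odd L → 3 ≤ L → Continuous ρ → Function.Injective ρ → (∀ g, ρ g ∈ Matrix.unitaryGroup (Fin N) ℂ) → (∃ g : G, g ≠ 1) → ∀ (β : ℝ), 0 < β → ∀ (q : Literature.MathematicalPhysics.QuantumFieldTheory.Plaquette d L), q.2.1.1 ≠ 0 → (q.1 0).val = L / 2 → 0 < Literature.MathematicalPhysics.QuantumFieldTheory.wilsonExpectation ρ β (fun U : Literature.MathematicalPhysics.QuantumFieldTheory.GaugeConfig d L G => Literature.MathematicalPhysics.QuantumFieldTheory.WilsonRP.plaqRe ρ U (q.1.timeReflect, q.2) * Literature.MathematicalPhysics.QuantumFieldTheory.WilsonRP.plaqRe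 ρ U q) - Literature.MathematicalPhysics.QuantumFieldTheory.wilsonExpectation ρ β (fun U : Literature.MathematicalPhysics.QuantumFieldTheory.GaugeConfig d L G => Literature.MathematicalPhysics.QuantumFieldTheory.WilsonRP.plaqRe ρ U (q.1.timeReflect, q.2)) * Literature.MathematicalPhysics.QuantumFieldTheory.wilsonExpectation ρ β (fun U : Literature.MathematicalPhysics.QuantumFieldTheory.GaugeConfig d L G => Literature.MathematicalPhysics.QuantumFieldTheory.WilsonRP.plaqRe ρ U q) := by
  intro d L N _ _ _ G _ _ _ _ _ _ ρ hL hL3 hρ hinj hunit hG β hβ q hq hqt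
  exact cov_timeReflect_pair_pos_odd ρ hL hL3 hρ hinj hunit hG hβ hq hqt

end Summit.QuantumFields.YangMills.Theorems.FemtoCurvatureTwoPoint.StrictRP

end
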